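import Mathlib
import HarnessLib
import Summits.HubbardSuperconductivity.HubbardSuperconductivity.Theorems.KLProgrammeKLRegimeEngineTwoLegStepV17F2ZeroCloser
import Summits.HubbardSuperconductivity.HubbardSuperconductivity.Theorems.KLProgrammeKLRegimeEngineTwoLegStepV17F2Closers
import Summits.HubbardSuperconductivity.HubbardSuperconductivity.Theorems.KLProgrammeKLRegimeEngineV8DefsU9

/-!
# K3 gen-8 engine-flow child `KLRegimeEngineV17F2` (stmt-HubbardSuperconductivity-20437), stub (M) `stub_twoLeg_scale0` ON ITS LITERAL BINDERS:
# the two-leg slot at scale `0` from stub 6-F's reading jets and the two nested legs — NOTHING ELSE (row (B) discharged through the (E3-THR) door;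
# three keyings: `klEngU₀7` (scale-0 sub-door), `klEngU₀8` (all-scales, P-free), `klEngU₀9` (all-scales ∧ cz·polynomial-killer — (R41d), THE REGISTERED ONE))

Cell gate-hubbard-kl, seat p1b (g8), (M) owner.  One application of p1b's `twoLegStepV17F2_zero_of_readJetBound_bareSlopes` (…TwoLegStepV17F2ZeroCloser)
at the REGISTERED package `klEngGeo7` / `klEngQ6 P R` and tables `klC4aJetC` / `klC4aJetC' P R`, with
* the regime converted from the registered thresholds (`c ≤ klEngC₃6 P R ≤ klCurveC3 R`, `U ≤ klEngU₀8 P R c ≤ klEngU₀3 ≤ klCurveU0 R ∧ ≤ 1`),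
* the covariance number `a₁ := klE3A1 R` (`bareAlphaOne_le_klE3A1`, …DefsU7 §1) and the four scale-`0` numerals DISCHARGED by the (E3-THR) door
  (`bareFrame_numerals_of_le_klE3U₀` / `_klEngU₀8` / `_klEngU₀9`, …DefsU7 §3–§4 / …DefsU9 — token #10 of the registration = `klEngU₀9`, plan g17 (R41d)),
* the package lines `klC4aJetC_le_klEngGeo7_S` (r2d-p1) / `klC4aJetC'_le_klEngQ6_S'` (c4a-1) and `klEngQ6_CL_nonneg`:
**`stub_twoLeg_scale0_of_nestedLegs_U9`** (+ the `_U7`/`_U8` keyings) — (M)'s literal binders (thresholds `klEngC₃6`, `klEngU₀9`; `FrameOK … (klFlowFrameU … 0)`, `EngineBoundsAtV17F2 … 0`,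
stub 6-F's `TwoLegReadJetBound … (klFlowFrameU … 0) 0`) + the two nested-leg rates `hcut`/`hsp` of the scale-`0` local part (VL lanes; empty histories)
⇒ `TwoLegStepV17F2 L M klEngGeo7 P (klEngQ6 P R) R β U μ 0`.  So (M) = stub 6-F@0 ∘ THIS ∘ (C).  Proofs only; no definitions.
References: BGM 2006 §3 (3.2)–(3.3), (2.40) [cite: BenfattoGiulianiMastropietro2006].
-/

noncomputable section

namespace Summit.HubbardSuperconductivity.HubbardSuperconductivity.Theorems.EngineV8

set_option linter.dupNamespace false -- summit = problem name (single-conjunct summit), D-0017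

open Real Finset Literature.MathematicalPhysics.QuantumLattice Literature.Probability.LatticeModels
open Literature.MathematicalPhysics.QuantumLattice.FermiRG Literature.MathematicalPhysics.QuantumLattice.BandSectorCounting
open Summit.HubbardSuperconductivity.HubbardSuperconductivity.Theorems.KLProgrammeLegKernels
open Summit.HubbardSuperconductivity.HubbardSuperconductivity.Theorems.DispersionFlow
open Summit.HubbardSuperconductivity.HubbardSuperconductivity.Theorems.PerturbedFermiCurve
open Summit.HubbardSuperconductivity.HubbardSuperconductivity.Theorems.KLRegimeSplit

/-- **STUB (M) ON ITS LITERAL BINDERS AT THE SCALE-0 SUB-DOOR `klEngU₀7`** (twin for a registration keyed on `klEngU₀7`): from the registered binders (`P.WF`, `R.WF2`, `0 < c ≤ klEngC₃6 P R`, `μ ∈ klWindowC`,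
`0 < U ≤ klEngU₀7 P R c`, `klBetaMin ≤ β ≤ e^{c/U²}`, the volume thresholds, `FrameOK … (klFlowFrameU … 0)`, the scale-`0` engine bounds, stub 6-F's
scale-`0` reading jets) and the two nested-leg rates of the scale-`0` local part: `TwoLegStepV17F2 L M klEngGeo7 P (klEngQ6 P R) R β U μ 0`. -/
theorem stub_twoLeg_scale0_of_nestedLegs_U7 (P : SplitConsts) (R : RenConsts) (c : ℝ) (hP : P.WF) (hR : R.WF2) (hc : 0 < c)
    (hc3 : c ≤ klEngC₃6 P R) (μ : ℝ) (hμ : μ ∈ klWindowC) (U : ℝ) (hU : 0 < U) (hUle : U ≤ klEngU₀7 P R c) (β : ℝ) (hβ : klBetaMin ≤ β)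
    (hβc : β ≤ Real.exp (c / U ^ 2)) (L M : ℕ) [NeZero L] [NeZero M] (hL : klEngL₃ β U ≤ L) (hM : klEngM₃ β U L ≤ M)
    (hfr : FrameOK R U (nScales β) μ (klFlowFrameU L M β U μ 0))
    (hE : EngineBoundsAtV17F2 L M klEngGeo7 P (klEngQ6 P R) β U μ 0)
    (hJ : TwoLegReadJetBound L M klC4aJetC (klC4aJetC' P R) β U μ (klFlowFrameU L M β U μ 0) 0)
    (hcut : ∀ (Mq : ℕ → ℕ) (L₁ M₁ M₂ : ℕ) [NeZero L₁] [NeZero M₁] [NeZero M₂], L ≤ L₁ → (klEngQ6 P R).M0 β L₁ ≤ M₁ → Mq L₁ ≤ M₁ →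
      M₁ ≤ M₂ →
      (∀ j < 0, histV17F2 L₁ M₁ klEngGeo7 P (klEngQ6 P R) R β U μ j ∧ TwoLegSlopes L₁ M₁ R β U μ (klFlowFrameU L₁ M₁ β U μ j) j) →
      (∀ j < 0, histV17F2 L₁ M₂ klEngGeo7 P (klEngQ6 P R) R β U μ j ∧ TwoLegSlopes L₁ M₂ R β U μ (klFlowFrameU L₁ M₂ β U μ j) j) →
        ∀ θ : ℝ, |klLocalPart L₁ M₁ β U μ (klFlowFrameU L₁ M₁ β U μ 0) 0 θ -
          klLocalPart L₁ M₂ β U μ (klFlowFrameU L₁ M₂ β U μ 0) 0 θ| ≤ (klEngQ6 P R).CL β 0 / 4 / L₁)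
    (hsp : ∀ (Mq : ℕ → ℕ) (L₁ L₂ M₂ : ℕ) [NeZero L₁] [NeZero L₂] [NeZero M₂], L ≤ L₁ → L₁ ∣ L₂ → (klEngQ6 P R).M0 β L₁ ≤ M₂ →
      Mq L₁ ≤ M₂ → (klEngQ6 P R).M0 β L₂ ≤ M₂ → Mq L₂ ≤ M₂ →
      (∀ j < 0, histV17F2 L₁ M₂ klEngGeo7 P (klEngQ6 P R) R β U μ j ∧ TwoLegSlopes L₁ M₂ R β U μ (klFlowFrameU L₁ M₂ β U μ j) j) →
      (∀ j < 0, histV17F2 L₂ M₂ klEngGeo7 P (klEngQ6 P R) R β U μ j ∧ TwoLegSlopes L₂ M₂ R β U μ (klFlowFrameU L₂ M₂ β U μ j) j) →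
        ∀ θ : ℝ, |klLocalPart L₁ M₂ β U μ (klFlowFrameU L₁ M₂ β U μ 0) 0 θ -
          klLocalPart L₂ M₂ β U μ (klFlowFrameU L₂ M₂ β U μ 0) 0 θ| ≤ (klEngQ6 P R).CL β 0 / 4 / L₁) :
    TwoLegStepV17F2 L M klEngGeo7 P (klEngQ6 P R) R β U μ 0 := by
  have _ := hP; have _ := hfr; have _ := hE
  have hRge : ∀ j, 0 ≤ R.Gfr j := hR.1.2.2
  have hcle : c ≤ klCurveC3 R := hc3.trans ((klEngC₃6_le_klEngC₃3 P R).trans (klEngC₃3_le_klCurveC3 P hRge))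
  have hU3 : U ≤ klEngU₀3 P R c := hUle.trans (klEngU₀7_le_klEngU₀3 P R c)
  have hUle' : U ≤ klCurveU0 R := hU3.trans (klEngU₀3_le_klCurveU0 P hRge c)
  have hU1 : U ≤ 1 := le_one_of_le_klEngU₀3 hU3
  have hU1' : |U| ≤ 1 := by rw [abs_of_pos hU]; exact hU1
  obtain ⟨hs0, hs1, hfz, hf1⟩ := bareFrame_numerals_of_le_klE3U₀ hR.2.2 hU (hUle.trans (klEngU₀7_le_klE3U₀ P R c))
  exact twoLegStepV17F2_zero_of_readJetBound_bareSlopes klEngGeo7 (klEngQ6 P R) hR.1 hc hcle hμ hU hUle' hU1 hβ hβc hL hM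
    (klEngQ6_CL_nonneg P R β 0) klC4aJetC_le_klEngGeo7_S (klC4aJetC'_le_klEngQ6_S' P R) hJ (klE3A1_pos R)
    (bareAlphaOne_le_klE3A1 R hU1') hs0 hs1 hfz hf1 hcut hsp


/-- **STUB (M) OF 20437 ON ITS LITERAL BINDERS, ROW (B) DISCHARGED**: from the registered binders (`P.WF`, `R.WF2`, `0 < c ≤ klEngC₃6 P R`, `μ ∈ klWindowC`,
`0 < U ≤ klEngU₀8 P R c`, `klBetaMin ≤ β ≤ e^{c/U²}`, the volume thresholds, `FrameOK … (klFlowFrameU … 0)`, the scale-`0` engine bounds, stub 6-F's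
scale-`0` reading jets) and the two nested-leg rates of the scale-`0` local part: `TwoLegStepV17F2 L M klEngGeo7 P (klEngQ6 P R) R β U μ 0`. -/
theorem stub_twoLeg_scale0_of_nestedLegs_U8 (P : SplitConsts) (R : RenConsts) (c : ℝ) (hP : P.WF) (hR : R.WF2) (hc : 0 < c)
    (hc3 : c ≤ klEngC₃6 P R) (μ : ℝ) (hμ : μ ∈ klWindowC) (U : ℝ) (hU : 0 < U) (hUle : U ≤ klEngU₀8 P R c) (β : ℝ) (hβ : klBetaMin ≤ β)
    (hβc : β ≤ Real.exp (c / U ^ 2)) (L M : ℕ) [NeZero L] [NeZero M] (hL : klEngL₃ β U ≤ L) (hM : klEngM₃ β U L ≤ M)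
    (hfr : FrameOK R U (nScales β) μ (klFlowFrameU L M β U μ 0))
    (hE : EngineBoundsAtV17F2 L M klEngGeo7 P (klEngQ6 P R) β U μ 0)
    (hJ : TwoLegReadJetBound L M klC4aJetC (klC4aJetC' P R) β U μ (klFlowFrameU L M β U μ 0) 0)
    (hcut : ∀ (Mq : ℕ → ℕ) (L₁ M₁ M₂ : ℕ) [NeZero L₁] [NeZero M₁] [NeZero M₂], L ≤ L₁ → (klEngQ6 P R).M0 β L₁ ≤ M₁ → Mq L₁ ≤ M₁ →
      M₁ ≤ M₂ →
      (∀ j < 0, histV17F2 L₁ M₁ klEngGeo7 P (klEngQ6 P R) R β U μ j ∧ TwoLegSlopes L₁ M₁ R β U μ (klFlowFrameU L₁ M₁ β U μ j) j) →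
      (∀ j < 0, histV17F2 L₁ M₂ klEngGeo7 P (klEngQ6 P R) R β U μ j ∧ TwoLegSlopes L₁ M₂ R β U μ (klFlowFrameU L₁ M₂ β U μ j) j) →
        ∀ θ : ℝ, |klLocalPart L₁ M₁ β U μ (klFlowFrameU L₁ M₁ β U μ 0) 0 θ -
          klLocalPart L₁ M₂ β U μ (klFlowFrameU L₁ M₂ β U μ 0) 0 θ| ≤ (klEngQ6 P R).CL β 0 / 4 / L₁)
    (hsp : ∀ (Mq : ℕ → ℕ) (L₁ L₂ M₂ : ℕ) [NeZero L₁] [NeZero L₂] [NeZero M₂], L ≤ L₁ → L₁ ∣ L₂ → (klEngQ6 P R).M0 β L₁ ≤ M₂ →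
      Mq L₁ ≤ M₂ → (klEngQ6 P R).M0 β L₂ ≤ M₂ → Mq L₂ ≤ M₂ →
      (∀ j < 0, histV17F2 L₁ M₂ klEngGeo7 P (klEngQ6 P R) R β U μ j ∧ TwoLegSlopes L₁ M₂ R β U μ (klFlowFrameU L₁ M₂ β U μ j) j) →
      (∀ j < 0, histV17F2 L₂ M₂ klEngGeo7 P (klEngQ6 P R) R β U μ j ∧ TwoLegSlopes L₂ M₂ R β U μ (klFlowFrameU L₂ M₂ β U μ j) j) →
        ∀ θ : ℝ, |klLocalPart L₁ M₂ β U μ (klFlowFrameU L₁ M₂ β U μ 0) 0 θ -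
          klLocalPart L₂ M₂ β U μ (klFlowFrameU L₂ M₂ β U μ 0) 0 θ| ≤ (klEngQ6 P R).CL β 0 / 4 / L₁) :
    TwoLegStepV17F2 L M klEngGeo7 P (klEngQ6 P R) R β U μ 0 := by
  have _ := hP; have _ := hfr; have _ := hE
  have hRge : ∀ j, 0 ≤ R.Gfr j := hR.1.2.2
  have hcle : c ≤ klCurveC3 R := hc3.trans ((klEngC₃6_le_klEngC₃3 P R).trans (klEngC₃3_le_klCurveC3 P hRge))
  have hU3 : U ≤ klEngU₀3 P R c := hUle.trans (klEngU₀8_le_klEngU₀3 P R c)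
  have hUle' : U ≤ klCurveU0 R := hU3.trans (klEngU₀3_le_klCurveU0 P hRge c)
  have hU1 : U ≤ 1 := le_one_of_le_klEngU₀3 hU3
  have hU1' : |U| ≤ 1 := by rw [abs_of_pos hU]; exact hU1
  obtain ⟨hs0, hs1, hfz, hf1⟩ := bareFrame_numerals_of_le_klEngU₀8 P hR.2.2 hU hUle
  exact twoLegStepV17F2_zero_of_readJetBound_bareSlopes klEngGeo7 (klEngQ6 P R) hR.1 hc hcle hμ hU hUle' hU1 hβ hβc hL hM
    (klEngQ6_CL_nonneg P R β 0) klC4aJetC_le_klEngGeo7_S (klC4aJetC'_le_klEngQ6_S' P R) hJ (klE3A1_pos R)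
    (bareAlphaOne_le_klE3A1 R hU1') hs0 hs1 hfz hf1 hcut hsp

/-- **STUB (M) ON ITS LITERAL (REGISTERED) BINDERS — token #10 = `klEngU₀9` ((R41d))**: from the registered binders (`P.WF`, `R.WF2`, `0 < c ≤ klEngC₃6 P R`, `μ ∈ klWindowC`,
`0 < U ≤ klEngU₀9 P R c`, `klBetaMin ≤ β ≤ e^{c/U²}`, the volume thresholds, `FrameOK … (klFlowFrameU … 0)`, the scale-`0` engine bounds, stub 6-F's
scale-`0` reading jets) and the two nested-leg rates of the scale-`0` local part: `TwoLegStepV17F2 L M klEngGeo7 P (klEngQ6 P R) R β U μ 0`. -/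
theorem stub_twoLeg_scale0_of_nestedLegs_U9 (P : SplitConsts) (R : RenConsts) (c : ℝ) (hP : P.WF) (hR : R.WF2) (hc : 0 < c)
    (hc3 : c ≤ klEngC₃6 P R) (μ : ℝ) (hμ : μ ∈ klWindowC) (U : ℝ) (hU : 0 < U) (hUle : U ≤ klEngU₀9 P R c) (β : ℝ) (hβ : klBetaMin ≤ β)
    (hβc : β ≤ Real.exp (c / U ^ 2)) (L M : ℕ) [NeZero L] [NeZero M] (hL : klEngL₃ β U ≤ L) (hM : klEngM₃ β U L ≤ M)
    (hfr : FrameOK R U (nScales β) μ (klFlowFrameU L M β U μ 0))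
    (hE : EngineBoundsAtV17F2 L M klEngGeo7 P (klEngQ6 P R) β U μ 0)
    (hJ : TwoLegReadJetBound L M klC4aJetC (klC4aJetC' P R) β U μ (klFlowFrameU L M β U μ 0) 0)
    (hcut : ∀ (Mq : ℕ → ℕ) (L₁ M₁ M₂ : ℕ) [NeZero L₁] [NeZero M₁] [NeZero M₂], L ≤ L₁ → (klEngQ6 P R).M0 β L₁ ≤ M₁ → Mq L₁ ≤ M₁ →
      M₁ ≤ M₂ →
      (∀ j < 0, histV17F2 L₁ M₁ klEngGeo7 P (klEngQ6 P R) R β U μ j ∧ TwoLegSlopes L₁ M₁ R β U μ (klFlowFrameU L₁ M₁ β U μ j) j) →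
      (∀ j < 0, histV17F2 L₁ M₂ klEngGeo7 P (klEngQ6 P R) R β U μ j ∧ TwoLegSlopes L₁ M₂ R β U μ (klFlowFrameU L₁ M₂ β U μ j) j) →
        ∀ θ : ℝ, |klLocalPart L₁ M₁ β U μ (klFlowFrameU L₁ M₁ β U μ 0) 0 θ -
          klLocalPart L₁ M₂ β U μ (klFlowFrameU L₁ M₂ β U μ 0) 0 θ| ≤ (klEngQ6 P R).CL β 0 / 4 / L₁)
    (hsp : ∀ (Mq : ℕ → ℕ) (L₁ L₂ M₂ : ℕ) [NeZero L₁] [NeZero L₂] [NeZero M₂], L ≤ L₁ → L₁ ∣ L₂ → (klEngQ6 P R).M0 β L₁ ≤ M₂ →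
      Mq L₁ ≤ M₂ → (klEngQ6 P R).M0 β L₂ ≤ M₂ → Mq L₂ ≤ M₂ →
      (∀ j < 0, histV17F2 L₁ M₂ klEngGeo7 P (klEngQ6 P R) R β U μ j ∧ TwoLegSlopes L₁ M₂ R β U μ (klFlowFrameU L₁ M₂ β U μ j) j) →
      (∀ j < 0, histV17F2 L₂ M₂ klEngGeo7 P (klEngQ6 P R) R β U μ j ∧ TwoLegSlopes L₂ M₂ R β U μ (klFlowFrameU L₂ M₂ β U μ j) j) →
        ∀ θ : ℝ, |klLocalPart L₁ M₂ β U μ (klFlowFrameU L₁ M₂ β U μ 0) 0 θ -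
          klLocalPart L₂ M₂ β U μ (klFlowFrameU L₂ M₂ β U μ 0) 0 θ| ≤ (klEngQ6 P R).CL β 0 / 4 / L₁) :
    TwoLegStepV17F2 L M klEngGeo7 P (klEngQ6 P R) R β U μ 0 := by
  have _ := hP; have _ := hfr; have _ := hE
  have hRge : ∀ j, 0 ≤ R.Gfr j := hR.1.2.2
  have hcle : c ≤ klCurveC3 R := hc3.trans ((klEngC₃6_le_klEngC₃3 P R).trans (klEngC₃3_le_klCurveC3 P hRge))
  have hU3 : U ≤ klEngU₀3 P R c := hUle.trans (klEngU₀9_le_klEngU₀3 P R c)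
  have hUle' : U ≤ klCurveU0 R := hU3.trans (klEngU₀3_le_klCurveU0 P hRge c)
  have hU1 : U ≤ 1 := le_one_of_le_klEngU₀3 hU3
  have hU1' : |U| ≤ 1 := by rw [abs_of_pos hU]; exact hU1
  obtain ⟨hs0, hs1, hfz, hf1⟩ := bareFrame_numerals_of_le_klEngU₀9 P hR.2.2 hU hUle
  exact twoLegStepV17F2_zero_of_readJetBound_bareSlopes klEngGeo7 (klEngQ6 P R) hR.1 hc hcle hμ hU hUle' hU1 hβ hβc hL hM
    (klEngQ6_CL_nonneg P R β 0) klC4aJetC_le_klEngGeo7_S (klC4aJetC'_le_klEngQ6_S' P R) hJ (klE3A1_pos R)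
    (bareAlphaOne_le_klE3A1 R hU1') hs0 hs1 hfz hf1 hcut hsp


end Summit.HubbardSuperconductivity.HubbardSuperconductivity.Theorems.EngineV8

end
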